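import Mathlib
import HarnessLib
import Literature.Computability.AlgebraicComplexity.ArithCircuit
import Literature.Computability.AlgebraicComplexity.CircuitDepth
import Literature.Computability.AlgebraicComplexity.StandardFamilies
import Literature.Computability.AlgebraicComplexity.ValiantClasses
import Literature.Computability.AlgebraicComplexity.ConstantFreeCircuits
import Literature.Computability.AlgebraicComplexity.ArithCircuitComposition
import Literature.Computability.AlgebraicComplexity.ArithCircuitProjections
import Literature.Computability.AlgebraicComplexity.RealTauConjectureDepthFour
import Literature.Computability.AlgebraicComplexity.DepthThreeChasmCircuits
import Literature.Computability.AlgebraicComplexity.AndrewsForbes2022BorderComposition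
import Summits.ValiantsHypothesis.Statement
import Summits.ValiantsHypothesis.ValiantsHypothesis.Theorems.SuccinctLiftAlgebraicConstants
import Summits.ValiantsHypothesis.ValiantsHypothesis.Theorems.SuccinctLiftBinaryNumerals

/-!
# SuccinctLift — the coefficient dial of wall K in ADVICE form; integer advice of polynomial
# height is free at fixed product depth (rung), and the exact split `K_alg ⟺ WALL-H ∧ WALL-D`

Route `route-ValiantsHypothesis-SuccinctLift` (lens 2 of the Valiant decomposition workshop), node
`K_alg = AlgConstantLiftLog3 : PerHardLog3CF → PerHardLog3Alg` (constant-free hardness of the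
permanent at product depth `Δ₁(n) = ⌊log₂⌊log₂⌊log₂ n⌋⌋⌋ + 1` and `n^c + c` wires implies hardness
against constants in `algebraicClosure ℚ ℂ`). This file coordinatizes the gap between the two ends
of `K_alg` by the Koiran–Perifel ADVICE presentation of constants (a circuit with constants is a
SIGN-constant integer circuit some of whose inputs are fed fixed scalars, Koiran–Perifel 2011 §2;
Bürgisser 2000 §4.3) and proves, in the kernel:

* the dial points (`Δ` a product-depth function; all with `n^c + c` wires, product depth `≤ Δ n`):
  `PerEasyCF Δ` (sign-constant integer circuits), `PerEasyPolyAdv Δ` (sign circuits with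
  `m ≤ n^c + c` integer advice leaves of height `≤ 2^(n^c+c)`), `PerEasyIntAdv Δ` (integer advice
  of arbitrary height), `PerEasyAlg Δ` (circuits over `algebraicClosure ℚ ℂ`);
* the RUNG `perEasyCF_of_perEasyPolyAdv` (= `intAdviceLiftAt`): integer advice of polynomial bit
  length can be ELIMINATED at the SAME product depth with polynomially many extra wires — each
  advice leaf `a` is replaced by a binary numeral sub-circuit made of SUM gates only
  (`binNumeral` of the companion file `Theorems/SuccinctLiftBinaryNumerals.lean`: a doubling chain
  `1, 2, 4, …, 2^L` and one signed sum over the binary digits of `|a|`; product depth `0`,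
  `≤ 3L + 2` wires, constants and coefficients in `{0, ±1}`), plugged in by circuit composition
  (`exists_signConst_of_intAdvice`; product depth not larger, wires additive);
* the trivial monotonicity of the dial (`perEasyPolyAdv_of_perEasyCF`,
  `perEasyIntAdv_of_perEasyPolyAdv`, `perEasyAlg_of_perEasyIntAdv`, the last through the tree's
  `perInDepthPoly_iff_algebraic`);
* hence the EXACT split of the node: `algConstantLiftAt_iff_split :
  AlgConstantLiftAt Δ ↔ HeightLiftAt Δ ∧ AlgDescentAt Δ`, where
  `HeightLiftAt Δ : ¬PerEasyPolyAdv Δ → ¬PerEasyIntAdv Δ` (WALL-H: advice of super-polynomial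
  height — exact arithmetic, no Chinese remaindering at fixed depth is known) and
  `AlgDescentAt Δ : ¬PerEasyIntAdv Δ → ¬PerEasyAlg Δ` (WALL-D: algebraic constants of unbounded
  degree and denominators → integer advice; Bürgisser 2000 Thm 4.13 reaches only an integral
  MULTIPLE and only over a FIXED number field), and the glue
  `algConstantLiftAt_of_lifts : HeightLiftAt Δ → AlgDescentAt Δ → AlgConstantLiftAt Δ`;
* the same statements at `Δ = Δ₁` in the route's inlined item form (`intAdviceLiftLog3`,
  `algConstantLiftLog3_of_lifts`, `algConstantLiftLog3_iff_lifts`).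

Honest framing: elementary circuit bookkeeping plus one genuine (easy) rung; the two walls stay
open and `VP ≠ VNP` is NOT proved here.

References: KoiranPerifel2011 (§2, advice presentation; Thm 9), Burgisser2000 (§4.1, §4.3,
Thm 4.13), Koiran2004, Burgisser2009 (§2.2, `τ(k) ≤ 2 log k`).
-/

namespace Summit.ValiantsHypothesis.ValiantsHypothesis.Theorems.SuccinctLift

open Literature.Computability.AlgebraicComplexity MvPolynomial

/-! ### §3 The coefficient dial of wall K (advice form) and its lifts -/

/-- Dial point D0 (`= PerHardLog3CF` negated, general `Δ`): per has `n^c + c`-wire, depth-`Δ(n)`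
circuits that are SIGN-constant integer circuits (read over `ℂ`). [cite: KoiranPerifel2011, §2] -/
def PerEasyCF (Δ : ℕ → ℕ) : Prop :=
  ∃ c : ℕ, ∀ n : ℕ, ∃ C : ArithCircuit ℤ (Fin (n * n)), ∃ C' : ArithCircuit ℂ (Fin n × Fin n),
    C' = (C.map (Int.castRingHom ℂ)).rename ⇑(finProdFinEquiv (m := n) (n := n)).symm ∧
    C.HasSignConstants ∧ C'.Computes (perPoly (Fin n) ℂ) ∧ C'.productDepth ≤ Δ n ∧
    C'.edgeSize ≤ n ^ c + c

/-- Dial point D1: per has `n^c + c`-wire, depth-`Δ(n)` circuits that are sign circuits with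
`m ≤ n^c + c` INTEGER ADVICE leaves of height `≤ 2^(n^c + c)`. [cite: KoiranPerifel2011, §2] -/
def PerEasyPolyAdv (Δ : ℕ → ℕ) : Prop :=
  ∃ c : ℕ, ∀ n : ℕ, ∃ m : ℕ, m ≤ n ^ c + c ∧ ∃ a : Fin m → ℤ,
    (∀ i, (a i).natAbs ≤ 2 ^ (n ^ c + c)) ∧
    ∃ C : ArithCircuit ℤ (Fin (n * n) ⊕ Fin m), C.HasSignConstants ∧
    ∃ C' : ArithCircuit ℂ (Fin n × Fin n),
      C' = ((C.substVC (Sum.elim Sum.inl fun i => Sum.inr (a i))).map (Int.castRingHom ℂ)).rename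
        ⇑(finProdFinEquiv (m := n) (n := n)).symm ∧
      C'.Computes (perPoly (Fin n) ℂ) ∧ C'.productDepth ≤ Δ n ∧ C'.edgeSize ≤ n ^ c + c

/-- Dial point D2: as D1 with integer advice of ARBITRARY height. [cite: KoiranPerifel2011, §2] -/
def PerEasyIntAdv (Δ : ℕ → ℕ) : Prop :=
  ∃ c : ℕ, ∀ n : ℕ, ∃ m : ℕ, m ≤ n ^ c + c ∧ ∃ a : Fin m → ℤ,
    ∃ C : ArithCircuit ℤ (Fin (n * n) ⊕ Fin m), C.HasSignConstants ∧
    ∃ C' : ArithCircuit ℂ (Fin n × Fin n),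
      C' = ((C.substVC (Sum.elim Sum.inl fun i => Sum.inr (a i))).map (Int.castRingHom ℂ)).rename
        ⇑(finProdFinEquiv (m := n) (n := n)).symm ∧
      C'.Computes (perPoly (Fin n) ℂ) ∧ C'.productDepth ≤ Δ n ∧ C'.edgeSize ≤ n ^ c + c

/-- Dial point Dℂ (`= PerHardLog3` negated, general `Δ`): per has `n^c + c`-wire, depth-`Δ(n)`
circuits over `ℂ`. [cite: LimayeSrinivasanTavenas2021, §1] -/
def PerEasyComplex (Δ : ℕ → ℕ) : Prop :=
  ∃ c : ℕ, ∀ n : ℕ, ∃ C : ArithCircuit ℂ (Fin n × Fin n),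
    C.Computes (perPoly (Fin n) ℂ) ∧ C.productDepth ≤ Δ n ∧ C.edgeSize ≤ n ^ c + c

/-- Dial point Dtop (`= PerHardLog3Alg` negated, general `Δ`): per has `n^c + c`-wire,
depth-`Δ(n)` circuits with constants in `algebraicClosure ℚ ℂ`. [cite: Burgisser2000, §4.1] -/
def PerEasyAlg (Δ : ℕ → ℕ) : Prop :=
  ∃ c : ℕ, ∀ n : ℕ, ∃ C : ArithCircuit ↥(algebraicClosure ℚ ℂ) (Fin n × Fin n),
    C.Computes (perPoly (Fin n) ↥(algebraicClosure ℚ ℂ)) ∧ C.productDepth ≤ Δ n ∧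
    C.edgeSize ≤ n ^ c + c

/-- **RUNG (integer advice of polynomial height is free at fixed product depth).** D1 ⟹ D0: a
depth-`Δ` poly-wire family of sign circuits with poly many integer advice leaves of polynomial bit
length yields a depth-`Δ` poly-wire family of sign circuits WITHOUT advice
(`exists_signConst_of_intAdvice` per `n`, plus `IsPBounded` bookkeeping of the wire count
`(n^c+c) + (n^c+c)(3(n^c+c)+2)`). [cite: KoiranPerifel2011, §2] -/
theorem perEasyCF_of_perEasyPolyAdv (Δ : ℕ → ℕ) (h : PerEasyPolyAdv Δ) : PerEasyCF Δ := by
  obtain ⟨c, hc⟩ := h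
  have hs : IsPBounded fun n : ℕ => n ^ c + c := ⟨c, fun n => le_rfl⟩
  obtain ⟨c', hc'⟩ : IsPBounded fun n : ℕ => (n ^ c + c) + (n ^ c + c) * (3 * (n ^ c + c) + 2) :=
    IsPBounded.add_holds hs (IsPBounded.mul_holds hs
      (IsPBounded.add_holds (IsPBounded.mul_holds (IsPBounded.const 3) hs) (IsPBounded.const 2)))
  refine ⟨c', fun n => ?_⟩
  obtain ⟨m, hm, a, ha, C, hC, C', rfl, hper, hd, hw⟩ := hc n
  obtain ⟨C₀, h₀s, h₀e, h₀d, h₀w⟩ := exists_signConst_of_intAdvice a ha C hC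
  refine ⟨C₀, _, rfl, h₀s, ?_, ?_, ?_⟩
  · unfold ArithCircuit.Computes at hper ⊢
    rw [ArithCircuit.eval_rename_apply, ArithCircuit.eval_map_apply, h₀e,
      ← ArithCircuit.eval_map_apply, ← ArithCircuit.eval_rename_apply, hper]
  · rw [DepthThreeChasm.productDepth_rename, ArithCircuit.productDepth_mapCoeff] at hd ⊢
    rw [ArithCircuit.productDepth_substVC] at hd
    exact h₀d.trans hd
  · rw [DepthThreeChasm.edgeSize_rename, ArithCircuit.edgeSize_mapCoeff] at hw ⊢
    rw [ArithCircuit.edgeSize_substVC] at hw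
    calc C₀.edgeSize ≤ C.edgeSize + m * (3 * (n ^ c + c) + 2) := h₀w
      _ ≤ (n ^ c + c) + (n ^ c + c) * (3 * (n ^ c + c) + 2) :=
          Nat.add_le_add hw (Nat.mul_le_mul_right _ hm)
      _ ≤ n ^ c' + c' := hc' n

/-- Dial monotonicity D0 ⟹ D1 (no advice is advice: `m = 0`, `C ↦ C.rename inl`).
[cite: KoiranPerifel2011, §2] -/
theorem perEasyPolyAdv_of_perEasyCF (Δ : ℕ → ℕ) (h : PerEasyCF Δ) : PerEasyPolyAdv Δ := by
  obtain ⟨c, hc⟩ := h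
  refine ⟨c, fun n => ?_⟩
  obtain ⟨C, C', rfl, hC, hper, hd, hw⟩ := hc n
  refine ⟨0, Nat.zero_le _, Fin.elim0, fun i => i.elim0, C.rename Sum.inl, hC.rename Sum.inl, _, rfl,
    ?_, ?_, ?_⟩
  · unfold ArithCircuit.Computes at hper ⊢
    rw [← hper, ArithCircuit.eval_rename_apply, ArithCircuit.eval_map_apply, ArithCircuit.eval_substVC,
      ArithCircuit.eval_rename_apply Sum.inl C, MvPolynomial.aeval_rename,
      ArithCircuit.eval_rename_apply, ArithCircuit.eval_map_apply]
    have hX : (ArithCircuit.substVCFun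
        (Sum.elim Sum.inl fun i => Sum.inr (Fin.elim0 i : ℤ) : Fin (n * n) ⊕ Fin 0 → Fin (n * n) ⊕ ℤ))
          ∘ Sum.inl = (X : Fin (n * n) → MvPolynomial (Fin (n * n)) ℤ) :=
      funext fun v => by simp [ArithCircuit.substVCFun]
    rw [hX, MvPolynomial.aeval_X_left_apply]
  · rw [DepthThreeChasm.productDepth_rename, ArithCircuit.productDepth_mapCoeff] at hd ⊢
    rw [ArithCircuit.productDepth_substVC, DepthThreeChasm.productDepth_rename]
    exact hd
  · rw [DepthThreeChasm.edgeSize_rename, ArithCircuit.edgeSize_mapCoeff] at hw ⊢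
    rw [ArithCircuit.edgeSize_substVC, DepthThreeChasm.edgeSize_rename]
    exact hw

/-- Dial monotonicity D1 ⟹ D2 (forget the height bound). [cite: KoiranPerifel2011, §2] -/
theorem perEasyIntAdv_of_perEasyPolyAdv (Δ : ℕ → ℕ) (h : PerEasyPolyAdv Δ) : PerEasyIntAdv Δ := by
  obtain ⟨c, hc⟩ := h
  refine ⟨c, fun n => ?_⟩
  obtain ⟨m, hm, a, -, C, hC, C', hC', hper, hd, hw⟩ := hc n
  exact ⟨m, hm, a, C, hC, C', hC', hper, hd, hw⟩

/-- Dial monotonicity D2 ⟹ Dℂ (an advice circuit read over `ℂ` is a complex circuit).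
[cite: KoiranPerifel2011, §2] -/
theorem perEasyComplex_of_perEasyIntAdv (Δ : ℕ → ℕ) (h : PerEasyIntAdv Δ) : PerEasyComplex Δ := by
  obtain ⟨c, hc⟩ := h
  refine ⟨c, fun n => ?_⟩
  obtain ⟨m, -, a, C, -, C', -, hper, hd, hw⟩ := hc n
  exact ⟨C', hper, hd, hw⟩

/-- Dℂ ⟺ Dtop (the tree's `perInDepthPoly_iff_algebraic`: algebraic constants suffice at a fixed
skeleton). [cite: Burgisser2000, §4.1] -/
theorem perEasyComplex_iff_perEasyAlg (Δ : ℕ → ℕ) : PerEasyComplex Δ ↔ PerEasyAlg Δ :=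
  perInDepthPoly_iff_algebraic Δ

/-- Dial monotonicity D2 ⟹ Dtop. [cite: Burgisser2000, §4.1] -/
theorem perEasyAlg_of_perEasyIntAdv (Δ : ℕ → ℕ) (h : PerEasyIntAdv Δ) : PerEasyAlg Δ :=
  (perEasyComplex_iff_perEasyAlg Δ).mp (perEasyComplex_of_perEasyIntAdv Δ h)

/-- Lift D0-hard ⟹ D1-hard (integer advice of polynomial height); PROVED below
(`intAdviceLiftAt`). [cite: KoiranPerifel2011, §2] -/
def IntAdviceLiftAt (Δ : ℕ → ℕ) : Prop := ¬ PerEasyCF Δ → ¬ PerEasyPolyAdv Δ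

/-- **WALL-H** (height lift) D1-hard ⟹ D2-hard: integer advice of SUPER-POLYNOMIAL height does not
shorten per at product depth `Δ`. Open: exact arithmetic at fixed depth offers no Chinese
remaindering / modular shortcut (Bürgisser 2000, §4.3 reaches Boolean statements only, under
GRH). [cite: Burgisser2000, §4.3] -/
def HeightLiftAt (Δ : ℕ → ℕ) : Prop := ¬ PerEasyPolyAdv Δ → ¬ PerEasyIntAdv Δ

/-- **WALL-D** (algebraic descent) D2-hard ⟹ Dtop-hard: constants in `algebraicClosure ℚ ℂ` (of
unbounded degree, with denominators) do not shorten per at product depth `Δ` beyond integer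
advice. Open: Bürgisser 2000 Thm 4.13 descends only from a FIXED number field and only to an
integral MULTIPLE. [cite: Burgisser2000, Thm. 4.13] -/
def AlgDescentAt (Δ : ℕ → ℕ) : Prop := ¬ PerEasyIntAdv Δ → ¬ PerEasyAlg Δ

/-- The node `K_alg` at general `Δ`: D0-hard ⟹ Dtop-hard. [cite: Burgisser2000, Ch. 4] -/
def AlgConstantLiftAt (Δ : ℕ → ℕ) : Prop := ¬ PerEasyCF Δ → ¬ PerEasyAlg Δ

/-- **The rung, lift form**: `IntAdviceLiftAt Δ` holds for every `Δ`. [cite: KoiranPerifel2011, §2] -/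
theorem intAdviceLiftAt (Δ : ℕ → ℕ) : IntAdviceLiftAt Δ :=
  fun h0 h1 => h0 (perEasyCF_of_perEasyPolyAdv Δ h1)

/-- **Glue**: WALL-H and WALL-D together give `K_alg` (the rung supplies D0 ⟹ D1).
[cite: KoiranPerifel2011, §2] -/
theorem algConstantLiftAt_of_lifts (Δ : ℕ → ℕ) (hH : HeightLiftAt Δ) (hD : AlgDescentAt Δ) :
    AlgConstantLiftAt Δ :=
  fun h0 => hD (hH (intAdviceLiftAt Δ h0))

/-- `K_alg` ⟹ WALL-H (dial monotonicity). [cite: KoiranPerifel2011, §2] -/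
theorem heightLiftAt_of_algConstantLiftAt (Δ : ℕ → ℕ) (hK : AlgConstantLiftAt Δ) : HeightLiftAt Δ :=
  fun h1 h2 => hK (fun h0 => h1 (perEasyPolyAdv_of_perEasyCF Δ h0)) (perEasyAlg_of_perEasyIntAdv Δ h2)

/-- `K_alg` ⟹ WALL-D (dial monotonicity). [cite: KoiranPerifel2011, §2] -/
theorem algDescentAt_of_algConstantLiftAt (Δ : ℕ → ℕ) (hK : AlgConstantLiftAt Δ) : AlgDescentAt Δ :=
  fun h2 => hK fun h0 => h2 (perEasyIntAdv_of_perEasyPolyAdv Δ (perEasyPolyAdv_of_perEasyCF Δ h0))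

/-- **EXACT SPLIT of the node**: `K_alg ⟺ WALL-H ∧ WALL-D` (for every depth function `Δ`).
[cite: KoiranPerifel2011, §2] -/
theorem algConstantLiftAt_iff_split (Δ : ℕ → ℕ) :
    AlgConstantLiftAt Δ ↔ HeightLiftAt Δ ∧ AlgDescentAt Δ :=
  ⟨fun hK => ⟨heightLiftAt_of_algConstantLiftAt Δ hK, algDescentAt_of_algConstantLiftAt Δ hK⟩,
    fun h => algConstantLiftAt_of_lifts Δ h.1 h.2⟩

/-- The three-lift form of the split (rung ∧ WALL-H ∧ WALL-D). [cite: KoiranPerifel2011, §2] -/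
theorem algConstantLiftAt_iff_split3 (Δ : ℕ → ℕ) :
    AlgConstantLiftAt Δ ↔ IntAdviceLiftAt Δ ∧ HeightLiftAt Δ ∧ AlgDescentAt Δ :=
  ⟨fun hK => ⟨intAdviceLiftAt Δ, (algConstantLiftAt_iff_split Δ).mp hK⟩,
    fun h => (algConstantLiftAt_iff_split Δ).mpr h.2⟩

/-- Vacuous necessity: Dtop-hard alone gives WALL-H. [cite: Burgisser2000, §4.1] -/
theorem heightLiftAt_of_perHardAlg (Δ : ℕ → ℕ) (h : ¬ PerEasyAlg Δ) : HeightLiftAt Δ :=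
  fun _ h2 => h (perEasyAlg_of_perEasyIntAdv Δ h2)

/-- Vacuous necessity: Dtop-hard alone gives WALL-D. [cite: Burgisser2000, §4.1] -/
theorem algDescentAt_of_perHardAlg (Δ : ℕ → ℕ) (h : ¬ PerEasyAlg Δ) : AlgDescentAt Δ :=
  fun _ => h

/-! ### §4 The route's inlined items at `Δ₁(n) = ⌊log₂⌊log₂⌊log₂ n⌋⌋⌋ + 1` -/

/-- **Rung `IntAdviceLiftLog3`** (route item form): constant-free hardness of per at depth `Δ₁`
implies hardness against sign circuits with poly many integer advice leaves of polynomial bit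
length. PROVED. [cite: KoiranPerifel2011, §2] -/
theorem intAdviceLiftLog3 :
    (¬ ∃ c : ℕ, ∀ n : ℕ, ∃ C : Literature.Computability.AlgebraicComplexity.ArithCircuit ℤ (Fin (n * n)), ∃ C' : Literature.Computability.AlgebraicComplexity.ArithCircuit ℂ (Fin n × Fin n), C' = (C.map (Int.castRingHom ℂ)).rename ⇑(finProdFinEquiv (m := n) (n := n)).symm ∧ C.HasSignConstants ∧ C'.Computes (Literature.Computability.AlgebraicComplexity.perPoly (Fin n) ℂ) ∧ C'.productDepth ≤ Nat.log 2 (Nat.log 2 (Nat.log 2 n)) + 1 ∧ C'.edgeSize ≤ n ^ c + c) → ¬ ∃ c : ℕ, ∀ n : ℕ, ∃ m : ℕ, m ≤ n ^ c + c ∧ ∃ a : Fin m → ℤ, (∀ i, (a i).natAbs ≤ 2 ^ (n ^ c + c)) ∧ ∃ C : Literature.Computability.AlgebraicComplexity.ArithCircuit ℤ (Fin (n * n) ⊕ Fin m), C.HasSignConstants ∧ ∃ C' : Literature.Computability.AlgebraicComplexity.ArithCircuit ℂ (Fin n × Fin n), C' = ((C.substVC (Sum.elim Sum.inl fun i =>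 Sum.inr (a i))).map (Int.castRingHom ℂ)).rename ⇑(finProdFinEquiv (m := n) (n := n)).symm ∧ C'.Computes (Literature.Computability.AlgebraicComplexity.perPoly (Fin n) ℂ) ∧ C'.productDepth ≤ Nat.log 2 (Nat.log 2 (Nat.log 2 n)) + 1 ∧ C'.edgeSize ≤ n ^ c + c :=
  intAdviceLiftAt fun n => Nat.log 2 (Nat.log 2 (Nat.log 2 n)) + 1

/-- **Glue `HeightLiftLog3 → AlgDescentLog3 → AlgConstantLiftLog3`** (route item form).
[cite: KoiranPerifel2011, §2] -/
theorem algConstantLiftLog3_of_lifts :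
    ((¬ ∃ c : ℕ, ∀ n : ℕ, ∃ m : ℕ, m ≤ n ^ c + c ∧ ∃ a : Fin m → ℤ, (∀ i, (a i).natAbs ≤ 2 ^ (n ^ c + c)) ∧ ∃ C : Literature.Computability.AlgebraicComplexity.ArithCircuit ℤ (Fin (n * n) ⊕ Fin m), C.HasSignConstants ∧ ∃ C' : Literature.Computability.AlgebraicComplexity.ArithCircuit ℂ (Fin n × Fin n), C' = ((C.substVC (Sum.elim Sum.inl fun i => Sum.inr (a i))).map (Int.castRingHom ℂ)).rename ⇑(finProdFinEquiv (m := n) (n := n)).symm ∧ C'.Computes (Literature.Computability.AlgebraicComplexity.perPoly (Fin n) ℂ) ∧ C'.productDepth ≤ Nat.log 2 (Nat.log 2 (Nat.log 2 n)) + 1 ∧ C'.edgeSize ≤ n ^ c + c) → ¬ ∃ c : ℕ, ∀ n : ℕ, ∃ m : ℕ, m ≤ n ^ c + c ∧ ∃ a : Fin m → ℤ, ∃ C : Literature.Computability.AlgebraicComplexity.ArithCircuit ℤ (Fin (n * n) ⊕ Fin m), C.HasSignConstants ∧ ∃ C' : Literature.Computability.AlgebraicComplexity.ArithCircuit ℂ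 (Fin n × Fin n), C' = ((C.substVC (Sum.elim Sum.inl fun i => Sum.inr (a i))).map (Int.castRingHom ℂ)).rename ⇑(finProdFinEquiv (m := n) (n := n)).symm ∧ C'.Computes (Literature.Computability.AlgebraicComplexity.perPoly (Fin n) ℂ) ∧ C'.productDepth ≤ Nat.log 2 (Nat.log 2 (Nat.log 2 n)) + 1 ∧ C'.edgeSize ≤ n ^ c + c) →
    ((¬ ∃ c : ℕ, ∀ n : ℕ, ∃ m : ℕ, m ≤ n ^ c + c ∧ ∃ a : Fin m → ℤ, ∃ C : Literature.Computability.AlgebraicComplexity.ArithCircuit ℤ (Fin (n * n) ⊕ Fin m), C.HasSignConstants ∧ ∃ C' : Literature.Computability.AlgebraicComplexity.ArithCircuit ℂ (Fin n × Fin n), C' = ((C.substVC (Sum.elim Sum.inl fun i => Sum.inr (a i))).map (Int.castRingHom ℂ)).rename ⇑(finProdFinEquiv (m := n) (n := n)).symm ∧ C'.Computes (Literature.Computability.AlgebraicComplexity.perPoly (Fin n) ℂ) ∧ C'.productDepth ≤ Nat.log 2 (Nat.log 2 (Nat.log 2 n)) + 1 ∧ C'.edgeSize ≤ n ^ c + c)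 → ¬ ∃ c : ℕ, ∀ n : ℕ, ∃ C : Literature.Computability.AlgebraicComplexity.ArithCircuit ↥(algebraicClosure ℚ ℂ) (Fin n × Fin n), C.Computes (Literature.Computability.AlgebraicComplexity.perPoly (Fin n) ↥(algebraicClosure ℚ ℂ)) ∧ C.productDepth ≤ Nat.log 2 (Nat.log 2 (Nat.log 2 n)) + 1 ∧ C.edgeSize ≤ n ^ c + c) →
    ((¬ ∃ c : ℕ, ∀ n : ℕ, ∃ C : Literature.Computability.AlgebraicComplexity.ArithCircuit ℤ (Fin (n * n)), ∃ C' : Literature.Computability.AlgebraicComplexity.ArithCircuit ℂ (Fin n × Fin n), C' = (C.map (Int.castRingHom ℂ)).rename ⇑(finProdFinEquiv (m := n) (n := n)).symm ∧ C.HasSignConstants ∧ C'.Computes (Literature.Computability.AlgebraicComplexity.perPoly (Fin n) ℂ) ∧ C'.productDepth ≤ Nat.log 2 (Nat.log 2 (Nat.log 2 n)) + 1 ∧ C'.edgeSize ≤ n ^ c + c) → ¬ ∃ c : ℕ, ∀ n : ℕ, ∃ C : Literature.Computability.AlgebraicComplexity.ArithCircuit ↥(algebraicClosure ℚ ℂ)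 (Fin n × Fin n), C.Computes (Literature.Computability.AlgebraicComplexity.perPoly (Fin n) ↥(algebraicClosure ℚ ℂ)) ∧ C.productDepth ≤ Nat.log 2 (Nat.log 2 (Nat.log 2 n)) + 1 ∧ C.edgeSize ≤ n ^ c + c) :=
  algConstantLiftAt_of_lifts fun n => Nat.log 2 (Nat.log 2 (Nat.log 2 n)) + 1

/-- **`AlgConstantLiftLog3 ⟺ HeightLiftLog3 ∧ AlgDescentLog3`** (route item form; the node is
split EXACTLY). [cite: KoiranPerifel2011, §2] -/
theorem algConstantLiftLog3_iff_lifts :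
    ((¬ ∃ c : ℕ, ∀ n : ℕ, ∃ C : Literature.Computability.AlgebraicComplexity.ArithCircuit ℤ (Fin (n * n)), ∃ C' : Literature.Computability.AlgebraicComplexity.ArithCircuit ℂ (Fin n × Fin n), C' = (C.map (Int.castRingHom ℂ)).rename ⇑(finProdFinEquiv (m := n) (n := n)).symm ∧ C.HasSignConstants ∧ C'.Computes (Literature.Computability.AlgebraicComplexity.perPoly (Fin n) ℂ) ∧ C'.productDepth ≤ Nat.log 2 (Nat.log 2 (Nat.log 2 n)) + 1 ∧ C'.edgeSize ≤ n ^ c + c) → ¬ ∃ c : ℕ, ∀ n : ℕ, ∃ C : Literature.Computability.AlgebraicComplexity.ArithCircuit ↥(algebraicClosure ℚ ℂ) (Fin n × Fin n), C.Computes (Literature.Computability.AlgebraicComplexity.perPoly (Fin n) ↥(algebraicClosure ℚ ℂ)) ∧ C.productDepth ≤ Nat.log 2 (Nat.log 2 (Nat.log 2 n)) + 1 ∧ C.edgeSize ≤ n ^ c + c) ↔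
    ((¬ ∃ c : ℕ, ∀ n : ℕ, ∃ m : ℕ, m ≤ n ^ c + c ∧ ∃ a : Fin m → ℤ, (∀ i, (a i).natAbs ≤ 2 ^ (n ^ c + c)) ∧ ∃ C : Literature.Computability.AlgebraicComplexity.ArithCircuit ℤ (Fin (n * n) ⊕ Fin m), C.HasSignConstants ∧ ∃ C' : Literature.Computability.AlgebraicComplexity.ArithCircuit ℂ (Fin n × Fin n), C' = ((C.substVC (Sum.elim Sum.inl fun i => Sum.inr (a i))).map (Int.castRingHom ℂ)).rename ⇑(finProdFinEquiv (m := n) (n := n)).symm ∧ C'.Computes (Literature.Computability.AlgebraicComplexity.perPoly (Fin n) ℂ) ∧ C'.productDepth ≤ Nat.log 2 (Nat.log 2 (Nat.log 2 n)) + 1 ∧ C'.edgeSize ≤ n ^ c + c) → ¬ ∃ c : ℕ, ∀ n : ℕ, ∃ m : ℕ, m ≤ n ^ c + c ∧ ∃ a : Fin m → ℤ, ∃ C : Literature.Computability.AlgebraicComplexity.ArithCircuit ℤ (Fin (n * n) ⊕ Fin m), C.HasSignConstants ∧ ∃ C' : Literature.Computability.AlgebraicComplexity.ArithCircuit ℂ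 (Fin n × Fin n), C' = ((C.substVC (Sum.elim Sum.inl fun i => Sum.inr (a i))).map (Int.castRingHom ℂ)).rename ⇑(finProdFinEquiv (m := n) (n := n)).symm ∧ C'.Computes (Literature.Computability.AlgebraicComplexity.perPoly (Fin n) ℂ) ∧ C'.productDepth ≤ Nat.log 2 (Nat.log 2 (Nat.log 2 n)) + 1 ∧ C'.edgeSize ≤ n ^ c + c) ∧
    ((¬ ∃ c : ℕ, ∀ n : ℕ, ∃ m : ℕ, m ≤ n ^ c + c ∧ ∃ a : Fin m → ℤ, ∃ C : Literature.Computability.AlgebraicComplexity.ArithCircuit ℤ (Fin (n * n) ⊕ Fin m), C.HasSignConstants ∧ ∃ C' : Literature.Computability.AlgebraicComplexity.ArithCircuit ℂ (Fin n × Fin n), C' = ((C.substVC (Sum.elim Sum.inl fun i => Sum.inr (a i))).map (Int.castRingHom ℂ)).rename ⇑(finProdFinEquiv (m := n) (n := n)).symm ∧ C'.Computes (Literature.Computability.AlgebraicComplexity.perPoly (Fin n) ℂ) ∧ C'.productDepth ≤ Nat.log 2 (Nat.log 2 (Nat.log 2 n)) + 1 ∧ C'.edgeSize ≤ n ^ c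 + c) → ¬ ∃ c : ℕ, ∀ n : ℕ, ∃ C : Literature.Computability.AlgebraicComplexity.ArithCircuit ↥(algebraicClosure ℚ ℂ) (Fin n × Fin n), C.Computes (Literature.Computability.AlgebraicComplexity.perPoly (Fin n) ↥(algebraicClosure ℚ ℂ)) ∧ C.productDepth ≤ Nat.log 2 (Nat.log 2 (Nat.log 2 n)) + 1 ∧ C.edgeSize ≤ n ^ c + c) :=
  algConstantLiftAt_iff_split fun n => Nat.log 2 (Nat.log 2 (Nat.log 2 n)) + 1

end Summit.ValiantsHypothesis.ValiantsHypothesis.Theorems.SuccinctLift
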